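import Summits.QuantumFields.BalabanUV.Beta.RootedT2JetDictionary
import Summits.QuantumFields.BalabanUV.Beta.RootedMixedJetSingle

/-!
# RootedT2JetSingle — 33K1: every term of 33I's `T2At` reflection laws at single letters, as a count

b2b / pub-balaban, unit `b2b-balaban-beta-an3` gen 33 (letter supplier AN3, border chain «B», file 3a of 3), BINDER-OWNERS
row D1 / typer row HR-W-LET.  Pure algebra over any ring `𝔸` and field `𝕜`; no analysis, no measure, no new constants.

HONEST FRAMING. «discharging BetaPertH makes Bałaban's UV stability UNCONDITIONAL — a real constructive-QFT result; it is
NOT the continuum limit and NOT the Clay problem.»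
HONEST DEPENDENCY. «continuum YM on T⁴ ⇐ BetaPertH ∧ nine spine estimates (0/9 proved); BetaPertH ⇐ (D1) ∧ (D4) ∧ CAP+tail;
G-an2-4 gates asym, D1 and NE2/3/4.»  This file discharges NO binder of row D1; it is the single-letter layer between the
jet-level laws (33I `RootedT2JetReflection`, 33J `RootedT2JetDictionary`) and BX2's bond-level border law `hB`
(`BorderLetterPacking.borderInv_of_bondLaw`), which 33K2 (`RootedBorderTableLaw`) lands from the `(0,3)` entries.

## Content (all `[folklore]`: 33G/33I/33J/33M2/33M3c letters and node 7aρ's single-letter identifications)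

Letters whose signed pull-backs are single-bond forms: `R1g α W = single F w`, `R1g α B = single G p`,
`R1g α B′ = single H q` (MX3 `R1g_single`).  Write `ℓ = L^d`, `Z_F = linCountAt ρ F`, `v = vhCountAt ρ`, `h = hessCountAt ρ`.
* §1 FORMS: `dR α B B′ = D1R α B · B′ = single G ([G = H on the axis]·[q,p])`;
  `A12R α W B B′ = single F ([F = G = H on the axis]·[q,[p,w]])`.
* §2 THE ONE COMBINED LAW at the reflected block `(μ, bref α μ y)` (33I's transverse and longitudinal laws, signs `ε_μ`):
  `T2At ω B B′ (bref α μ y) = ε_μ • (T2At ω♯ B♯ B′♯ y + CT(B,B′) + CT(B′,B) + [μ = α]·(CJ(B,B′) + CJ(B′,B)))`.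
* §3 COMPONENTS AT SINGLE LETTERS: `CT(upF W; B, B′) = (2ℓ²)⁻¹ • (v(F,H) • [[F=G ax]·[p,w], q] + v(F,G) • [[F=H ax]·[q,w], p])
  + ℓ⁻¹ • (Z_F • [F=G=H ax]·[q,[p,w]])`; `c10 NR = ℓ⁻¹ • Z_G • p`, `c01 NR = ℓ⁻¹ • Z_H • q`,
  `c11 NR = (2ℓ)⁻¹ • (h(G,H) • [p,q] + Z_G • [G=H]·[p,q]) + ℓ⁻¹ • Z_G • [G=H ax]·[q,p] + (2ℓ²)⁻¹ • {Z_G p, Z_H q}`;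
  the three jet components entering 33I's `CJ`: `X₀₀ = ℓ⁻¹ • Z_F • w`, `X₀₁ = (2ℓ²)⁻¹ • v(F,H) • [w,q] + ℓ⁻¹ • Z_F • [F=H ax]·[q,w]`,
  `X₁₀ = (2ℓ²)⁻¹ • v(F,G) • [w,p] + ℓ⁻¹ • Z_F • [F=G ax]·[p,w]`.
* §4 SIGNS: the signs of `R1g_single` pull out of `T2At` at single letters (33F `T2At_neg_ω`, 33J `T2At_upF_neg_B/B′`), and
  `R1g α (single f (±c)) = single (fref α f) c` for the sign `±` of `R1g_single`.

## What is NOT here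
No matrices, no `(0,3)` entries, no table, no `hB`: that is 33K2 (`RootedBorderTableLaw`).
-/

namespace Summit.QuantumFields.BalabanUV.Beta.RootedT2JetSingle

open Literature.MathematicalPhysics.QuantumFieldTheory.Balaban1983to89
open Literature.MathematicalPhysics.QuantumFieldTheory.Balaban1983to89.Beta
open AffineAveraging (Form1)
open AveragingContoursRooted (ctr linAvgAt)
open AveragingHessianKernels (Bond single single_apply bw bw_single)
open AveragingHessianKernelsRooted (hessUAt vhUAt linCountAt hessCountAt vhCountAt linAvgAt_single hessUAt_single vhUAt_single)
open AveragingThirdJet (Tau upF)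
open AveragingThirdJet.Tau (c00 c10 c01 c11)
open AveragingMixedJetTables (QjetAt T2At)
open ResolventReflection (sref bref bref_of_ne)
open RootedKernelReflection (fref)
open Summit.QuantumFields.BalabanUV.Beta.RootedHolonomyReflection (R1g)
open Summit.QuantumFields.BalabanUV.Beta.RootedJetReflectionExpanded (dR ad1R ad12R)
open Summit.QuantumFields.BalabanUV.Beta.RootedJetLinear (T2At_neg_ω)
open Summit.QuantumFields.BalabanUV.Beta.RootedMixedJetLinear (upF_neg)
open Summit.QuantumFields.BalabanUV.Beta.RootedMixedJetReflectionLaw (D1R)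
open Summit.QuantumFields.BalabanUV.Beta.RootedMixedJetSigns (R1g_single)
open Summit.QuantumFields.BalabanUV.Beta.RootedMixedJetSingle (D1R_of_single single_neg)
open Summit.QuantumFields.BalabanUV.Beta.RootedT2JetReflection (CT NR CJ T2At_sref_of_ne T2At_bref_self)
open Summit.QuantumFields.BalabanUV.Beta.RootedT2JetDictionary (R1g_upF ad1R_upF A12R ad12R_upF T2At_upF_neg_B T2At_upF_neg_B'
  c00_QjetAt_upF c10_QjetAt_upF c01_QjetAt_upF c10_NR c01_NR c11_NR)

variable {𝕜 : Type*} [Field 𝕜] {d : ℕ} {𝔸 : Type*} [Ring 𝔸] [Algebra 𝕜 𝔸]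

/-! ## §1 The background letters `dR`, `A12R` at single letters -/

section Forms

variable {α : Fin d} {W B B' : Form1 d 𝔸} {F G H : Bond d} {w p q : 𝔸}

/-- [folklore] 33G's `dR α B B′` IS 33M2's `D1R α B · B′` (the middle slot of `D1R` is mute). -/
theorem dR_eq_D1R (α : Fin d) (B V B' : Form1 d 𝔸) : dR α B B' = D1R α B V B' := by
  funext κ x
  by_cases h : κ = α
  · simp only [dR, D1R, if_pos h]
  · simp only [dR, D1R, if_neg h]

/-- [folklore] `dR` at single letters: supported on `G`, with value `[q, p]` iff `G = H` lies on the axis (33M3c `D1R_of_single`). -/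
theorem dR_of_single (hB : R1g α B = single G p) (hB' : R1g α B' = single H q) :
    dR α B B' = single G (if G = H ∧ G.1 = α then AveragingHessianKernels.comm q p else 0) := by
  rw [dR_eq_D1R α B B B']
  exact D1R_of_single hB hB' B

/-- [folklore] 33J's `A12R` at single letters: supported on `F`, with value `[q, [p, w]]` iff `F = G = H` lies on the axis. -/
theorem A12R_of_single (hW : R1g α W = single F w) (hB : R1g α B = single G p) (hB' : R1g α B' = single H q) :
    A12R α W B B' = single F (if F = G ∧ F = H ∧ F.1 = α then
      AveragingHessianKernels.comm q (AveragingHessianKernels.comm p w) else 0) := by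
  funext κ x
  simp only [A12R, hW, hB, hB', single_apply, AveragingHessianKernels.comm]
  by_cases hF : (κ, x) = F
  · subst hF
    by_cases hG : (κ, x) = G
    · subst hG
      by_cases hH : (κ, x) = H
      · subst hH
        by_cases h1 : κ = α <;> simp [h1]
      · simp [hH]
    · simp [hG]
  · simp [hF]

end Forms

/-! ## §2 The one combined reflection law of `T2At` at the reflected block -/

section Law

variable (𝕜) {L : ℕ} (hL : Odd L) (h2 : (2 : 𝕜) ≠ 0)
include hL h2

/-- [folklore] **33I's TWO LAWS AS ONE**: at the reflected block `(μ, bref α μ y)` (`bref = sref` off the axis),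
`T2At ω B B′ = ε_μ • (T2At ω♯ B♯ B′♯ + CT(B,B′) + CT(B′,B) + [μ = α]·(CJ(B,B′) + CJ(B′,B)))` at `(μ, y)`, `ε_μ = −1` iff `μ = α`
(33I `T2At_sref_of_ne`, `T2At_bref_self`). -/
theorem T2At_bref (α μ : Fin d) (ω : Form1 d (Tau 𝔸)) (B B' : Form1 d 𝔸) (y : Fin d → ℤ) :
    T2At 𝕜 (ctr d L) ω B B' L μ (bref α μ y)
      = (if μ = α then -1 else 1 : ℤ) •
        (T2At 𝕜 (ctr d L) (R1g α ω) (R1g α B) (R1g α B') L μ y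
          + CT 𝕜 (ctr d L) α ω B B' L μ y + CT 𝕜 (ctr d L) α ω B' B L μ y
          + (if μ = α then CJ 𝕜 (ctr d L) α ω B B' L μ y + CJ 𝕜 (ctr d L) α ω B' B L μ y else 0)) := by
  by_cases hμ : μ = α
  · subst hμ
    rw [T2At_bref_self 𝕜 hL h2, if_pos rfl, if_pos rfl, neg_one_zsmul]
    abel
  · rw [bref_of_ne hμ, T2At_sref_of_ne 𝕜 hL hμ, if_neg hμ, if_neg hμ, one_zsmul, add_zero]

end Law

/-! ## §3 The components at single letters, every one a count -/

section Components

variable {L : ℕ} (hL : (L : 𝕜) ≠ 0) (h2 : (2 : 𝕜) ≠ 0) (ρ : Fin d → ℤ)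
include hL

include h2 in
/-- [folklore] 33I's `CT` AT A SCALAR FLUCTUATION `ω = upF W`, IN NODE-7aρ FUNCTIONALS (33J §1, §4):
`CT = (2ℓ²)⁻¹ • (vhUAt ρ (D1R α W · B) c + vhUAt ρ (D1R α W · B′) b) + ℓ⁻¹ • Z(A12R α W B B′)`. -/
theorem CT_upF (α : Fin d) (W B B' : Form1 d 𝔸) (μ : Fin d) (y : Fin d → ℤ) :
    CT 𝕜 ρ α (upF W) B B' L μ y
      = ((2 : 𝕜) * (L : 𝕜) ^ (2 * d))⁻¹ • (vhUAt ρ (D1R α W W B) (R1g α B') L μ y + vhUAt ρ (D1R α W W B') (R1g α B) L μ y)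
        + ((L : 𝕜) ^ d)⁻¹ • linAvgAt ρ (A12R α W B B') L μ y := by
  simp only [CT, ad1R_upF, ad12R_upF, c01_QjetAt_upF hL h2, c10_QjetAt_upF hL h2, c00_QjetAt_upF hL, smul_add]

variable {α : Fin d} {W B B' : Form1 d 𝔸} {F G H : Bond d} {w p q : 𝔸}

include h2 in
/-- [folklore] **`CT` AT SINGLE LETTERS** (`CT_upF`, 33M3c `D1R_of_single`, §1 `A12R_of_single`, node 7aρ `vhUAt_single`,
`linAvgAt_single`). -/
theorem CT_of_single (hW : R1g α W = single F w) (hB : R1g α B = single G p) (hB' : R1g α B' = single H q) (μ : Fin d)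
    (y : Fin d → ℤ) :
    CT 𝕜 ρ α (upF W) B B' L μ y
      = ((2 : 𝕜) * (L : 𝕜) ^ (2 * d))⁻¹ •
          (vhCountAt ρ L μ y F H •
              AveragingHessianKernels.comm (if F = G ∧ F.1 = α then AveragingHessianKernels.comm p w else 0) q
            + vhCountAt ρ L μ y F G •
              AveragingHessianKernels.comm (if F = H ∧ F.1 = α then AveragingHessianKernels.comm q w else 0) p)
        + ((L : 𝕜) ^ d)⁻¹ • (linCountAt ρ L μ y F •
            (if F = G ∧ F = H ∧ F.1 = α then AveragingHessianKernels.comm q (AveragingHessianKernels.comm p w) else 0)) := by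
  rw [CT_upF hL h2, D1R_of_single hW hB W, D1R_of_single hW hB' W, hB, hB', A12R_of_single hW hB hB', vhUAt_single,
    vhUAt_single, linAvgAt_single]

/-- [folklore] `c10 NR = ℓ⁻¹ • Z_G • p` at a single first background (33J `c10_NR`). -/
theorem c10_NR_of_single (hB : R1g α B = single G p) (B' : Form1 d 𝔸) (μ : Fin d) (y : Fin d → ℤ) :
    c10 (NR 𝕜 ρ α B B' L μ y) = ((L : 𝕜) ^ d)⁻¹ • (linCountAt ρ L μ y G • p) := by
  rw [c10_NR hL, hB, linAvgAt_single]

/-- [folklore] `c01 NR = ℓ⁻¹ • Z_H • q` at a single second background (33J `c01_NR`). -/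
theorem c01_NR_of_single (hB' : R1g α B' = single H q) (B : Form1 d 𝔸) (μ : Fin d) (y : Fin d → ℤ) :
    c01 (NR 𝕜 ρ α B B' L μ y) = ((L : 𝕜) ^ d)⁻¹ • (linCountAt ρ L μ y H • q) := by
  rw [c01_NR hL, hB', linAvgAt_single]

include h2 in
/-- [folklore] **`c11 NR` AT SINGLE LETTERS** (33J `c11_NR`; node 7aρ `hessUAt_single`, node 7a `bw_single`, §1 `dR_of_single`):
`(2ℓ)⁻¹ • (h(G,H) • [p,q] + Z_G • [G=H]·[p,q]) + ℓ⁻¹ • (Z_G • [G=H ax]·[q,p]) + (2ℓ²)⁻¹ • {Z_G • p, Z_H • q}`. -/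
theorem c11_NR_of_single (hB : R1g α B = single G p) (hB' : R1g α B' = single H q) (μ : Fin d) (y : Fin d → ℤ) :
    c11 (NR 𝕜 ρ α B B' L μ y)
      = ((2 : 𝕜) * (L : 𝕜) ^ d)⁻¹ •
          (hessCountAt ρ L μ y G H • AveragingHessianKernels.comm p q
            + linCountAt ρ L μ y G • (if G = H then AveragingHessianKernels.comm p q else 0))
        + ((L : 𝕜) ^ d)⁻¹ • (linCountAt ρ L μ y G • (if G = H ∧ G.1 = α then AveragingHessianKernels.comm q p else 0))
        + ((2 : 𝕜) * (L : 𝕜) ^ (2 * d))⁻¹ •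
          ((linCountAt ρ L μ y G • p) * (linCountAt ρ L μ y H • q) + (linCountAt ρ L μ y H • q) * (linCountAt ρ L μ y G • p)) := by
  rw [c11_NR hL h2, dR_of_single hB hB', hB, hB', hessUAt_single, bw_single]
  simp only [linAvgAt_single]

/-- [folklore] THE SHADOW COMPONENT `X₀₀ = c00 Q(ω♯; b, c) = ℓ⁻¹ • Z_F • w` (33J `R1g_upF`, `c00_QjetAt_upF`). -/
theorem X00_of_single (hW : R1g α W = single F w) (B B' : Form1 d 𝔸) (μ : Fin d) (y : Fin d → ℤ) :
    c00 (QjetAt 𝕜 ρ (R1g α (upF W)) (R1g α B) (R1g α B') L μ y) = ((L : 𝕜) ^ d)⁻¹ • (linCountAt ρ L μ y F • w) := by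
  rw [R1g_upF, hW, c00_QjetAt_upF hL, linAvgAt_single]

include h2 in
/-- [folklore] THE COMPONENT `X₀₁ = c01 Q(ω♯; b, c) + c00 Q(ad1R α ω B′; b, c)` of 33I's `CJ` at single letters:
`(2ℓ²)⁻¹ • v(F,H) • [w,q] + ℓ⁻¹ • Z_F • [F=H ax]·[q,w]`. -/
theorem X01_of_single (hW : R1g α W = single F w) (hB' : R1g α B' = single H q) (B : Form1 d 𝔸) (μ : Fin d) (y : Fin d → ℤ) :
    c01 (QjetAt 𝕜 ρ (R1g α (upF W)) (R1g α B) (R1g α B') L μ y) + c00 (QjetAt 𝕜 ρ (ad1R α (upF W) B') (R1g α B) (R1g α B') L μ y)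
      = ((2 : 𝕜) * (L : 𝕜) ^ (2 * d))⁻¹ • (vhCountAt ρ L μ y F H • AveragingHessianKernels.comm w q)
        + ((L : 𝕜) ^ d)⁻¹ • (linCountAt ρ L μ y F • (if F = H ∧ F.1 = α then AveragingHessianKernels.comm q w else 0)) := by
  rw [R1g_upF, ad1R_upF, D1R_of_single hW hB' W, hW, hB', c01_QjetAt_upF hL h2, c00_QjetAt_upF hL, vhUAt_single, linAvgAt_single]

include h2 in
/-- [folklore] THE COMPONENT `X₁₀ = c10 Q(ω♯; b, c) + c00 Q(ad1R α ω B; b, c)`: `(2ℓ²)⁻¹ • v(F,G) • [w,p] + ℓ⁻¹ • Z_F • [F=G ax]·[p,w]`. -/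
theorem X10_of_single (hW : R1g α W = single F w) (hB : R1g α B = single G p) (B' : Form1 d 𝔸) (μ : Fin d) (y : Fin d → ℤ) :
    c10 (QjetAt 𝕜 ρ (R1g α (upF W)) (R1g α B) (R1g α B') L μ y) + c00 (QjetAt 𝕜 ρ (ad1R α (upF W) B) (R1g α B) (R1g α B') L μ y)
      = ((2 : 𝕜) * (L : 𝕜) ^ (2 * d))⁻¹ • (vhCountAt ρ L μ y F G • AveragingHessianKernels.comm w p)
        + ((L : 𝕜) ^ d)⁻¹ • (linCountAt ρ L μ y F • (if F = G ∧ F.1 = α then AveragingHessianKernels.comm p w else 0)) := by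
  rw [R1g_upF, ad1R_upF, D1R_of_single hW hB W, hW, hB, c10_QjetAt_upF hL h2, c00_QjetAt_upF hL, vhUAt_single, linAvgAt_single]

end Components

/-! ## §4 Signs -/

/-- [folklore] THE SIGNS OF `R1g_single` PULL OUT OF `T2At` AT SINGLE LETTERS (33F `T2At_neg_ω`, 33M1 `upF_neg`, 33M3c `single_neg`,
33J `T2At_upF_neg_B`, `T2At_upF_neg_B′`). -/
theorem T2At_upF_single_signs (ρ : Fin d → ℤ) (F G H : Bond d) (w p q : 𝔸) (P Q R : Prop) [Decidable P] [Decidable Q]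
    [Decidable R] (L : ℕ) (μ : Fin d) (y : Fin d → ℤ) :
    T2At 𝕜 ρ (upF (single F (if P then -w else w))) (single G (if Q then -p else p)) (single H (if R then -q else q)) L μ y
      = ((if P then -1 else 1 : ℤ) * (if Q then -1 else 1 : ℤ) * (if R then -1 else 1 : ℤ))
          • T2At 𝕜 ρ (upF (single F w)) (single G p) (single H q) L μ y := by
  split_ifs <;> simp [single_neg, upF_neg, T2At_neg_ω, T2At_upF_neg_B, T2At_upF_neg_B']

/-- [folklore] The pull-back of the SIGNED single letter is the plain letter on the reflected bond:
`R1g α (single f (±c)) = single (fref α f) c` for the sign of `R1g_single`. -/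
theorem R1g_single_signed (α : Fin d) (f : Bond d) (c : 𝔸) :
    R1g α (single f (if f.1 = α then -c else c)) = single (fref α f) c := by
  rw [R1g_single]
  congr 1
  split_ifs <;> simp

end Summit.QuantumFields.BalabanUV.Beta.RootedT2JetSingle
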